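import Literature.Topology.FourManifolds.CircleQuarterArcs
import Literature.Geometry.Manifold.OpenEmbeddingCriterion
import HarnessLib

/-!
# Tubes of the horizontal circles `S¹ × {θ}` of the torus `S¹ × S¹` recharted on `ℝ²`

Topic `Literature/Topology/FourManifolds` (fact seat of the Seiberg–Witten leaf
`Literature.Barriers.SmoothPoincare4.akhmedovPark2010_lemma8_invariants`; block 1 of
Akhmedov–Park's `X₁(m)`, A. Akhmedov, B. D. Park, Invent. Math. 181 (2010), §9 eq. (9.1): the
curves `a₁`, `b₁`, `a₂` of `Σ₂ = T² # T²` and `c`, `d` of `T²` along which the four Luttinger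
surgery tori `a₁′ × c′, b₁′ × c″, a₂′ × c′, a₂″ × d′` are built are standard circles of tori,
`a = S¹ × {pt}`, `b = {pt} × S¹`, and their parallel copies `′`, `″`).  The torus of the tree's
genus-two surface is Mathlib's Lie group `S¹ × S¹` (`Circle × Circle`) recharted on `ℝ²` along a
linear isomorphism `f : ℝ¹ × ℝ¹ ≃ ℝ²` (`Literature.Geometry.Manifold.Rechart`, as in
`exists_twoTorus_model`, `ClosedOrientableSurfaces.lean`).  For such a recharting `f` (smooth
both ways: hypotheses `hf`, `hf'`, satisfied by every linear `f`,
`Rechart.contMDiff_of_apply_eq_linear`) and a centre `θ ∈ S¹` this file proves that the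
**horizontal curve tube**

  `H_θ : S¹ × ℝ¹ → T`, `(s, u) ↦ into (s, θ · exp(i arctan(u₀)/2))`

— the circle `S¹ × {θ}` thickened by the quarter arc about `θ` in the second factor
(`CircleQuarterArcs.lean`) — is a smooth embedding with open range
`{x | Re((out x).2 θ⁻¹) > 0 ∧ Re(((out x).2 θ⁻¹)²) > 0}` (`isSmoothEmbedding_of_leftInverse_of_isOpenMap`
with the rational left inverse `u₀ = Im(w²)/Re(w²)`, `w = (out x).2 θ⁻¹`), i.e. a *curve tube* in
the sense of the torus-tube constructions of block 1.  Vertical circles `{θ} × S¹` are the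
horizontal ones of the torus recharted along `f ∘ swap` and are not treated separately here.
Everything is proved; no definitions (the maps are bare expressions).

## References

* A. Akhmedov, B. D. Park, Invent. Math. 181 (2010), §2 and §9 eq. (9.1). [AkhmedovPark2010]
* J. M. Lee, *Introduction to Smooth Manifolds* (2013), Prop. 5.2. [LeeSmoothManifolds2013]
-/

noncomputable section

open scoped Manifold ContDiff Topology
open Set Function
open Literature.Geometry.Manifold (Rechart)

namespace Literature.Topology.FourManifolds

section Horizontal

variable {f : ModelProd (EuclideanSpace ℝ (Fin 1)) (EuclideanSpace ℝ (Fin 1)) ≃ₜ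
    EuclideanSpace ℝ (Fin 2)}

/-- The rational left inverse `w ↦ Im(w²)/Re(w²)` of the quarter arc is `C^∞` on the open set
`Re(w²) ≠ 0` of `ℂ`. [folklore] -/
theorem contDiffOn_im_sq_div_re_sq :
    ContDiffOn ℝ ∞ (fun w : ℂ => (w ^ 2).im / (w ^ 2).re) {w : ℂ | (w ^ 2).re ≠ 0} := by
  have h2 : ContDiff ℝ ∞ fun w : ℂ => w ^ 2 := contDiff_id.pow 2
  exact (Complex.imCLM.contDiff.comp h2).contDiffOn.div
    (Complex.reCLM.contDiff.comp h2).contDiffOn fun w hw => hw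

/-- **The horizontal curve tube `(s, u) ↦ into (s, θ · exp(i arctan(u₀)/2))` of the recharted
torus is a smooth embedding with open range**, the range being the product of `S¹` with the
quarter arc about `θ`: `{x | Re((out x).2 θ⁻¹) > 0 ∧ Re(((out x).2 θ⁻¹)²) > 0}`.  (Akhmedov–Park
2010 §9: the circles `a = S¹ × {pt}` of the tori and their parallel copies `a′`, `a″` — different
centres `θ` give disjoint parallel copies when the arcs are disjoint.)
[cite: AkhmedovPark2010, §2 and §9 eq. (9.1)] [cite: LeeSmoothManifolds2013, Prop. 5.2] -/
theorem isSmoothEmbedding_horizontalCurveTube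
    (hf : ContMDiff ((𝓡 1).prod (𝓡 1)) 𝓘(ℝ, EuclideanSpace ℝ (Fin 2)) ∞ f)
    (hf' : ContMDiff 𝓘(ℝ, EuclideanSpace ℝ (Fin 2)) ((𝓡 1).prod (𝓡 1)) ∞ f.symm) (θ : Circle) :
    Manifold.IsSmoothEmbedding ((𝓡 1).prod (𝓡 1)) (𝓡 2) ∞
        (fun q : Circle × EuclideanSpace ℝ (Fin 1) =>
          Rechart.into f (Circle × Circle) (q.1, θ * Circle.exp (Real.arctan (q.2 0) / 2))) ∧
      IsOpen (range fun q : Circle × EuclideanSpace ℝ (Fin 1) =>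
          Rechart.into f (Circle × Circle) (q.1, θ * Circle.exp (Real.arctan (q.2 0) / 2))) ∧
      (range fun q : Circle × EuclideanSpace ℝ (Fin 1) =>
          Rechart.into f (Circle × Circle) (q.1, θ * Circle.exp (Real.arctan (q.2 0) / 2))) =
        {x | 0 < (((Rechart.out f (Circle × Circle) x).2 * θ⁻¹ : Circle) : ℂ).re ∧
          0 < ((((Rechart.out f (Circle × Circle) x).2 * θ⁻¹ : Circle) : ℂ) ^ 2).re} := by
  haveI hT : IsManifold (𝓡 2) ∞ (Rechart f (Circle × Circle)) := Rechart.isManifold f _ hf hf'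
  haveI : Fact (Module.finrank ℝ ℂ = 1 + 1) := finrank_real_complex_fact'
  -- notation
  let arc : ℝ → Circle := fun t => θ * Circle.exp (Real.arctan t / 2)
  let ℓ : Circle → ℝ := fun z => (((z * θ⁻¹ : Circle) : ℂ) ^ 2).im / (((z * θ⁻¹ : Circle) : ℂ) ^ 2).re
  let e₀ : EuclideanSpace ℝ (Fin 1) := EuclideanSpace.single 0 1
  have he₀ : ∀ u : EuclideanSpace ℝ (Fin 1), (u 0) • e₀ = u := fun u => by
    ext i
    fin_cases i
    simp [e₀]
  have he₀' : ∀ a : ℝ, (a • e₀) 0 = a := fun a => by simp [e₀]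
  obtain ⟨harc_inj, harc_sm, harc_open⟩ := injective_contMDiff_isOpenMap_mul_circleExp_arctan_half θ
  -- the tube and its left inverse
  let H : Circle × EuclideanSpace ℝ (Fin 1) → Rechart f (Circle × Circle) :=
    fun q => Rechart.into f (Circle × Circle) (q.1, arc (q.2 0))
  let finv : Rechart f (Circle × Circle) → Circle × EuclideanSpace ℝ (Fin 1) :=
    fun x => ((Rechart.out f (Circle × Circle) x).1, (ℓ (Rechart.out f (Circle × Circle) x).2) • e₀)
  have hℓarc : ∀ t, ℓ (arc t) = t := fun t => by
    show (((θ * Circle.exp (Real.arctan t / 2) * θ⁻¹ : Circle) : ℂ) ^ 2).im /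
        (((θ * Circle.exp (Real.arctan t / 2) * θ⁻¹ : Circle) : ℂ) ^ 2).re = t
    rw [mul_inv_cancel_comm]
    exact im_sq_div_re_sq_circleExp_arctan_half t
  have hleft : ∀ q, finv (H q) = q := by
    rintro ⟨s, u⟩
    show ((Rechart.out f (Circle × Circle) (Rechart.into f (Circle × Circle) (s, arc (u 0)))).1, (ℓ (Rechart.out f (Circle × Circle) (Rechart.into f (Circle × Circle) (s, arc (u 0)))).2) • e₀) = (s, u)
    rw [Rechart.out_into]
    simp only [hℓarc, he₀]
  have hinj : Injective H := fun x y h => by rw [← hleft x, ← hleft y, h]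
  -- smoothness of `H`
  have hproj : ContMDiff (𝓡 1) 𝓘(ℝ, ℝ) ∞ (fun u : EuclideanSpace ℝ (Fin 1) => u 0) :=
    (EuclideanSpace.proj (𝕜 := ℝ) (ι := Fin 1) 0).contMDiff
  have hinto : ContMDiff ((𝓡 1).prod (𝓡 1)) (𝓡 2) ∞ (Rechart.into f (Circle × Circle)) :=
    Rechart.contMDiff_into f _ hf hf'
  have hout : ContMDiff (𝓡 2) ((𝓡 1).prod (𝓡 1)) ∞ (Rechart.out f (Circle × Circle)) :=
    Rechart.contMDiff_out f _ hf hf'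
  have hHsm : ContMDiff ((𝓡 1).prod (𝓡 1)) (𝓡 2) ∞ H :=
    hinto.comp (contMDiff_fst.prodMk (harc_sm.comp (hproj.comp contMDiff_snd)))
  -- `H` is an open map
  have hopen : IsOpenMap H := by
    let πE : EuclideanSpace ℝ (Fin 1) ≃ₜ ℝ :=
      (EuclideanSpace.equiv (Fin 1) ℝ).toHomeomorph.trans (Homeomorph.funUnique (Fin 1) ℝ)
    have hπE : ∀ u : EuclideanSpace ℝ (Fin 1), πE u = u 0 := fun u => rfl
    have hS : IsOpenMap fun q : Circle × EuclideanSpace ℝ (Fin 1) => (q.1, arc (q.2 0)) := by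
      have : (fun q : Circle × EuclideanSpace ℝ (Fin 1) => (q.1, arc (q.2 0))) =
          Prod.map id arc ∘ Prod.map id πE := by
        funext q; rfl
      rw [this]
      exact (IsOpenMap.id.prodMap harc_open).comp (IsOpenMap.id.prodMap πE.isOpenMap)
    have hH : H = (Rechart.outHomeomorph f (Circle × Circle)).symm ∘
        fun q : Circle × EuclideanSpace ℝ (Fin 1) => (q.1, arc (q.2 0)) := by
      funext q; rfl
    rw [hH]
    exact (Rechart.outHomeomorph f (Circle × Circle)).symm.isOpenMap.comp hS
  -- the left inverse is smooth on the range
  have hrange_arc : ∀ x ∈ range H, 0 < ((((Rechart.out f (Circle × Circle) x).2 * θ⁻¹ : Circle) : ℂ)).re ∧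
      0 < ((((Rechart.out f (Circle × Circle) x).2 * θ⁻¹ : Circle) : ℂ) ^ 2).re := by
    rintro _ ⟨⟨s, u⟩, rfl⟩
    show 0 < ((((Rechart.out f (Circle × Circle) (Rechart.into f (Circle × Circle) (s, arc (u 0)))).2 * θ⁻¹ : Circle) : ℂ)).re ∧
      0 < ((((Rechart.out f (Circle × Circle) (Rechart.into f (Circle × Circle) (s, arc (u 0)))).2 * θ⁻¹ : Circle) : ℂ) ^ 2).re
    rw [Rechart.out_into]
    show 0 < (((θ * Circle.exp (Real.arctan (u 0) / 2) * θ⁻¹ : Circle) : ℂ)).re ∧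
      0 < (((θ * Circle.exp (Real.arctan (u 0) / 2) * θ⁻¹ : Circle) : ℂ) ^ 2).re
    rw [mul_inv_cancel_comm]
    exact ⟨re_circleExp_arctan_half_pos _, re_sq_circleExp_arctan_half_pos _⟩
  have hcoe : ContMDiff (𝓡 1) 𝓘(ℝ, ℂ) ∞ (fun z : Circle => (z : ℂ)) := contMDiff_coe_sphere
  have hrot : ContMDiff (𝓡 1) (𝓡 1) ∞ (fun z : Circle => z * θ⁻¹) := contMDiff_mul_right
  have hℓ : ContMDiffOn (𝓡 1) 𝓘(ℝ, ℝ) ∞ ℓ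
      {z : Circle | 0 < ((((z * θ⁻¹ : Circle) : ℂ)) ^ 2).re} := by
    refine (contDiffOn_im_sq_div_re_sq.contMDiffOn.comp (hcoe.comp hrot).contMDiffOn ?_)
    intro z hz
    exact ne_of_gt hz
  have hz₂ : ContMDiff (𝓡 2) (𝓡 1) ∞ fun x => (Rechart.out f (Circle × Circle) x).2 := contMDiff_snd.comp hout
  have hℓ₂ : ContMDiffOn (𝓡 2) 𝓘(ℝ, ℝ) ∞ (fun x => ℓ (Rechart.out f (Circle × Circle) x).2) (range H) :=
    hℓ.comp hz₂.contMDiffOn fun x hx => (hrange_arc x hx).2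
  have hfinv : ContMDiffOn (𝓡 2) ((𝓡 1).prod (𝓡 1)) ∞ finv (range H) := by
    refine (contMDiff_fst.comp hout).contMDiffOn.prodMk ?_
    exact hℓ₂.smul contMDiffOn_const
  -- conclusion
  let L : (EuclideanSpace ℝ (Fin 1) × EuclideanSpace ℝ (Fin 1)) ≃L[ℝ] EuclideanSpace ℝ (Fin 2) :=
    ContinuousLinearEquiv.ofFinrankEq (by simp)
  obtain ⟨hemb, hopenRange⟩ :=
    Literature.Geometry.Manifold.isSmoothEmbedding_of_leftInverse_of_isOpenMap
      (IY := (𝓡 1).prod (𝓡 1)) (I := 𝓡 2) hHsm hinj hopen hfinv hleft L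
  refine ⟨hemb, hopenRange, ?_⟩
  -- the range
  ext x
  constructor
  · intro hx
    exact hrange_arc x hx
  · rintro ⟨h₁, h₂⟩
    refine ⟨((Rechart.out f (Circle × Circle) x).1, (ℓ (Rechart.out f (Circle × Circle) x).2) • e₀), ?_⟩
    show Rechart.into f (Circle × Circle) ((Rechart.out f (Circle × Circle) x).1, arc ((ℓ (Rechart.out f (Circle × Circle) x).2 • e₀) 0)) = x
    rw [he₀']
    have hz : Circle.exp (Real.arctan (ℓ (Rechart.out f (Circle × Circle) x).2) / 2) = (Rechart.out f (Circle × Circle) x).2 * θ⁻¹ :=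
      circleExp_arctan_half_eq h₁ h₂
    have harc : arc (ℓ (Rechart.out f (Circle × Circle) x).2) = (Rechart.out f (Circle × Circle) x).2 := by
      simp only [arc]
      rw [hz, mul_inv_cancel_comm_assoc]
    rw [harc, Prod.mk.eta, Rechart.into_out]

/-! ### Vertical curve tubes -/

/-- **The vertical curve tube `(s, u) ↦ into (θ · exp(i arctan(u₀)/2), s)` of the recharted
torus is a smooth embedding with open range** `{x | Re((out x).1 θ⁻¹) > 0 ∧ Re(((out x).1 θ⁻¹)²) > 0}`
(the quarter arc about `θ` in the FIRST factor times `S¹`; Akhmedov–Park 2010 §9: the circles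
`b = {pt} × S¹` of the tori).  Same proof as `isSmoothEmbedding_horizontalCurveTube` with the two
factors exchanged.
[cite: AkhmedovPark2010, §2 and §9 eq. (9.1)] [cite: LeeSmoothManifolds2013, Prop. 5.2] -/
theorem isSmoothEmbedding_verticalCurveTube
    (hf : ContMDiff ((𝓡 1).prod (𝓡 1)) 𝓘(ℝ, EuclideanSpace ℝ (Fin 2)) ∞ f)
    (hf' : ContMDiff 𝓘(ℝ, EuclideanSpace ℝ (Fin 2)) ((𝓡 1).prod (𝓡 1)) ∞ f.symm) (θ : Circle) :
    Manifold.IsSmoothEmbedding ((𝓡 1).prod (𝓡 1)) (𝓡 2) ∞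
        (fun q : Circle × EuclideanSpace ℝ (Fin 1) =>
          Rechart.into f (Circle × Circle) (θ * Circle.exp (Real.arctan (q.2 0) / 2), q.1)) ∧
      IsOpen (range fun q : Circle × EuclideanSpace ℝ (Fin 1) =>
          Rechart.into f (Circle × Circle) (θ * Circle.exp (Real.arctan (q.2 0) / 2), q.1)) ∧
      (range fun q : Circle × EuclideanSpace ℝ (Fin 1) =>
          Rechart.into f (Circle × Circle) (θ * Circle.exp (Real.arctan (q.2 0) / 2), q.1)) =
        {x | 0 < (((Rechart.out f (Circle × Circle) x).1 * θ⁻¹ : Circle) : ℂ).re ∧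
          0 < ((((Rechart.out f (Circle × Circle) x).1 * θ⁻¹ : Circle) : ℂ) ^ 2).re} := by
  haveI hT : IsManifold (𝓡 2) ∞ (Rechart f (Circle × Circle)) := Rechart.isManifold f _ hf hf'
  haveI : Fact (Module.finrank ℝ ℂ = 1 + 1) := finrank_real_complex_fact'
  -- notation
  let arc : ℝ → Circle := fun t => θ * Circle.exp (Real.arctan t / 2)
  let ℓ : Circle → ℝ := fun z => (((z * θ⁻¹ : Circle) : ℂ) ^ 2).im / (((z * θ⁻¹ : Circle) : ℂ) ^ 2).re
  let e₀ : EuclideanSpace ℝ (Fin 1) := EuclideanSpace.single 0 1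
  have he₀ : ∀ u : EuclideanSpace ℝ (Fin 1), (u 0) • e₀ = u := fun u => by
    ext i
    fin_cases i
    simp [e₀]
  have he₀' : ∀ a : ℝ, (a • e₀) 0 = a := fun a => by simp [e₀]
  obtain ⟨harc_inj, harc_sm, harc_open⟩ := injective_contMDiff_isOpenMap_mul_circleExp_arctan_half θ
  -- the tube and its left inverse
  let H : Circle × EuclideanSpace ℝ (Fin 1) → Rechart f (Circle × Circle) :=
    fun q => Rechart.into f (Circle × Circle) (arc (q.2 0), q.1)
  let finv : Rechart f (Circle × Circle) → Circle × EuclideanSpace ℝ (Fin 1) :=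
    fun x => ((Rechart.out f (Circle × Circle) x).2, (ℓ (Rechart.out f (Circle × Circle) x).1) • e₀)
  have hℓarc : ∀ t, ℓ (arc t) = t := fun t => by
    show (((θ * Circle.exp (Real.arctan t / 2) * θ⁻¹ : Circle) : ℂ) ^ 2).im /
        (((θ * Circle.exp (Real.arctan t / 2) * θ⁻¹ : Circle) : ℂ) ^ 2).re = t
    rw [mul_inv_cancel_comm]
    exact im_sq_div_re_sq_circleExp_arctan_half t
  have hleft : ∀ q, finv (H q) = q := by
    rintro ⟨s, u⟩
    show ((Rechart.out f (Circle × Circle) (Rechart.into f (Circle × Circle) (arc (u 0), s))).2, (ℓ (Rechart.out f (Circle × Circle) (Rechart.into f (Circle × Circle) (arc (u 0), s))).1) • e₀) = (s, u)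
    rw [Rechart.out_into]
    simp only [hℓarc, he₀]
  have hinj : Injective H := fun x y h => by rw [← hleft x, ← hleft y, h]
  -- smoothness of `H`
  have hproj : ContMDiff (𝓡 1) 𝓘(ℝ, ℝ) ∞ (fun u : EuclideanSpace ℝ (Fin 1) => u 0) :=
    (EuclideanSpace.proj (𝕜 := ℝ) (ι := Fin 1) 0).contMDiff
  have hinto : ContMDiff ((𝓡 1).prod (𝓡 1)) (𝓡 2) ∞ (Rechart.into f (Circle × Circle)) :=
    Rechart.contMDiff_into f _ hf hf'
  have hout : ContMDiff (𝓡 2) ((𝓡 1).prod (𝓡 1)) ∞ (Rechart.out f (Circle × Circle)) :=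
    Rechart.contMDiff_out f _ hf hf'
  have hHsm : ContMDiff ((𝓡 1).prod (𝓡 1)) (𝓡 2) ∞ H :=
    hinto.comp ((harc_sm.comp (hproj.comp contMDiff_snd)).prodMk contMDiff_fst)
  -- `H` is an open map
  have hopen : IsOpenMap H := by
    let πE : EuclideanSpace ℝ (Fin 1) ≃ₜ ℝ :=
      (EuclideanSpace.equiv (Fin 1) ℝ).toHomeomorph.trans (Homeomorph.funUnique (Fin 1) ℝ)
    have hπE : ∀ u : EuclideanSpace ℝ (Fin 1), πE u = u 0 := fun u => rfl
    have hS : IsOpenMap fun q : Circle × EuclideanSpace ℝ (Fin 1) => (arc (q.2 0), q.1) := by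
      have : (fun q : Circle × EuclideanSpace ℝ (Fin 1) => (arc (q.2 0), q.1)) =
          Prod.map arc id ∘ Prod.swap ∘ Prod.map id πE := by
        funext q; rfl
      rw [this]
      exact ((harc_open.prodMap IsOpenMap.id).comp (Homeomorph.prodComm _ _).isOpenMap).comp
        (IsOpenMap.id.prodMap πE.isOpenMap)
    have hH : H = (Rechart.outHomeomorph f (Circle × Circle)).symm ∘
        fun q : Circle × EuclideanSpace ℝ (Fin 1) => (arc (q.2 0), q.1) := by
      funext q; rfl
    rw [hH]
    exact (Rechart.outHomeomorph f (Circle × Circle)).symm.isOpenMap.comp hS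
  -- the left inverse is smooth on the range
  have hrange_arc : ∀ x ∈ range H, 0 < ((((Rechart.out f (Circle × Circle) x).1 * θ⁻¹ : Circle) : ℂ)).re ∧
      0 < ((((Rechart.out f (Circle × Circle) x).1 * θ⁻¹ : Circle) : ℂ) ^ 2).re := by
    rintro _ ⟨⟨s, u⟩, rfl⟩
    show 0 < ((((Rechart.out f (Circle × Circle) (Rechart.into f (Circle × Circle) (arc (u 0), s))).1 * θ⁻¹ : Circle) : ℂ)).re ∧
      0 < ((((Rechart.out f (Circle × Circle) (Rechart.into f (Circle × Circle) (arc (u 0), s))).1 * θ⁻¹ : Circle) : ℂ) ^ 2).re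
    rw [Rechart.out_into]
    show 0 < (((θ * Circle.exp (Real.arctan (u 0) / 2) * θ⁻¹ : Circle) : ℂ)).re ∧
      0 < (((θ * Circle.exp (Real.arctan (u 0) / 2) * θ⁻¹ : Circle) : ℂ) ^ 2).re
    rw [mul_inv_cancel_comm]
    exact ⟨re_circleExp_arctan_half_pos _, re_sq_circleExp_arctan_half_pos _⟩
  have hcoe : ContMDiff (𝓡 1) 𝓘(ℝ, ℂ) ∞ (fun z : Circle => (z : ℂ)) := contMDiff_coe_sphere
  have hrot : ContMDiff (𝓡 1) (𝓡 1) ∞ (fun z : Circle => z * θ⁻¹) := contMDiff_mul_right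
  have hℓ : ContMDiffOn (𝓡 1) 𝓘(ℝ, ℝ) ∞ ℓ
      {z : Circle | 0 < ((((z * θ⁻¹ : Circle) : ℂ)) ^ 2).re} := by
    refine (contDiffOn_im_sq_div_re_sq.contMDiffOn.comp (hcoe.comp hrot).contMDiffOn ?_)
    intro z hz
    exact ne_of_gt hz
  have hz₂ : ContMDiff (𝓡 2) (𝓡 1) ∞ fun x => (Rechart.out f (Circle × Circle) x).1 := contMDiff_fst.comp hout
  have hℓ₂ : ContMDiffOn (𝓡 2) 𝓘(ℝ, ℝ) ∞ (fun x => ℓ (Rechart.out f (Circle × Circle) x).1) (range H) :=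
    hℓ.comp hz₂.contMDiffOn fun x hx => (hrange_arc x hx).2
  have hfinv : ContMDiffOn (𝓡 2) ((𝓡 1).prod (𝓡 1)) ∞ finv (range H) := by
    refine (contMDiff_snd.comp hout).contMDiffOn.prodMk ?_
    exact hℓ₂.smul contMDiffOn_const
  -- conclusion
  let L : (EuclideanSpace ℝ (Fin 1) × EuclideanSpace ℝ (Fin 1)) ≃L[ℝ] EuclideanSpace ℝ (Fin 2) :=
    ContinuousLinearEquiv.ofFinrankEq (by simp)
  obtain ⟨hemb, hopenRange⟩ :=
    Literature.Geometry.Manifold.isSmoothEmbedding_of_leftInverse_of_isOpenMap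
      (IY := (𝓡 1).prod (𝓡 1)) (I := 𝓡 2) hHsm hinj hopen hfinv hleft L
  refine ⟨hemb, hopenRange, ?_⟩
  -- the range
  ext x
  constructor
  · intro hx
    exact hrange_arc x hx
  · rintro ⟨h₁, h₂⟩
    refine ⟨((Rechart.out f (Circle × Circle) x).2, (ℓ (Rechart.out f (Circle × Circle) x).1) • e₀), ?_⟩
    show Rechart.into f (Circle × Circle) (arc ((ℓ (Rechart.out f (Circle × Circle) x).1 • e₀) 0), (Rechart.out f (Circle × Circle) x).2) = x
    rw [he₀']
    have hz : Circle.exp (Real.arctan (ℓ (Rechart.out f (Circle × Circle) x).1) / 2) = (Rechart.out f (Circle × Circle) x).1 * θ⁻¹ :=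
      circleExp_arctan_half_eq h₁ h₂
    have harc : arc (ℓ (Rechart.out f (Circle × Circle) x).1) = (Rechart.out f (Circle × Circle) x).1 := by
      simp only [arc]
      rw [hz, mul_inv_cancel_comm_assoc]
    rw [harc, Prod.mk.eta, Rechart.into_out]

end Horizontal

end Literature.Topology.FourManifolds
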